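import Literature.Geometry.Lorentzian.BackgroundChartCalculus
import HarnessLib

/-!
# Charts smooth on part of the background domain: local immersion and orientation lemmas

Localised versions of `BackgroundChartCalculus.lean` for chart maps `Ψ : B.domain → 𝓢` that are
smooth only on the part `val⁻¹' W` over an open `W ⊆ B.domain` (time translates of a chart defined
after some time, restricted charts): on `W` the parametrisation `Ψ ∘ (chartAt E4 x).symm` is
smooth, its components differ from the background by the deviation, a `C⁰`-pinched point is a point
where `Ψ` is a local diffeomorphism, and on a preconnected `S ⊆ W` the orientation of `dΨ(∂₀)` is
decided at one point.

## References
* B. O'Neill, *Semi-Riemannian geometry*, Academic Press 1983, Ch. 3, p. 90; Ch. 5, Lemma 5.26. [ONeill1983]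
-/

noncomputable section

open Set Filter TopologicalSpace Bundle Function
open scoped Manifold ContDiff Topology

universe u

namespace Literature.Geometry.Lorentzian

namespace Spacetime

variable (𝓢 : Spacetime.{u} 4) (B : ModelBackground)

/-- A chart map smooth on `val⁻¹' W` gives a parametrisation `Ψ ∘ (chartAt E4 x).symm` smooth on
`W` (for `W ⊆ B.domain`). [folklore] -/
theorem contMDiffOn_comp_chartAt_symm_of_contMDiffOn (Ψ : B.domain → 𝓢.carrier) (x : B.domain)
    {W : Set E4} (hW : W ⊆ (B.domain : Set E4))
    (hΨ : ContMDiffOn 𝓘(ℝ, E4) (𝓡 4) ∞ Ψ (Subtype.val ⁻¹' W)) :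
    ContMDiffOn 𝓘(ℝ, E4) (𝓡 4) ∞ (Ψ ∘ (chartAt E4 x).symm) W := by
  refine hΨ.comp ((contMDiffOn_chart_symm (H := E4) (I := 𝓘(ℝ, E4)) (x := x)).mono ?_) ?_
  · rw [OpensChart.chartAt_target]; exact hW
  · intro y hy
    show ((chartAt E4 x).symm y : E4) ∈ W
    rw [OpensChart.chartAt_symm_val x (hW hy)]
    exact hy

/-- Smoothness on the piece gives differentiability of `Ψ` at its points. [folklore] -/
theorem mdifferentiableAt_of_contMDiffOn_preimage (Ψ : B.domain → 𝓢.carrier) {W : Set E4}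
    (hWo : IsOpen W) (hΨ : ContMDiffOn 𝓘(ℝ, E4) (𝓡 4) ∞ Ψ (Subtype.val ⁻¹' W)) {y : E4}
    (hy : y ∈ (B.domain : Set E4)) (hyW : y ∈ W) :
    MDifferentiableAt 𝓘(ℝ, E4) (𝓡 4) Ψ ⟨y, hy⟩ :=
  ((hΨ ⟨y, hy⟩ hyW).contMDiffAt ((hWo.preimage continuous_subtype_val).mem_nhds hyW)).mdifferentiableAt
    (by simp)

/-- Pointwise form of the bridge: `‖metricInCoords (Ψ ∘ (chartAt E4 x).symm) y − g₀(y)‖ =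
‖deviationExtend B Ψ y‖` at a point of differentiability. [folklore] -/
theorem norm_metricInCoords_comp_chartAt_symm_sub_of_mdifferentiableAt (Ψ : B.domain → 𝓢.carrier)
    (x : B.domain) {y : E4} (hy : y ∈ (B.domain : Set E4))
    (hΨ : MDifferentiableAt 𝓘(ℝ, E4) (𝓡 4) Ψ ⟨y, hy⟩) :
    ‖𝓢.metricInCoords (Ψ ∘ (chartAt E4 x).symm) y - B.bilin y‖ = ‖𝓢.deviationExtend B Ψ y‖ := by
  rw [𝓢.metricInCoords_comp_chartAt_symm_sub_eq_deviation B Ψ x hy hΨ, 𝓢.deviationExtend_coe B Ψ ⟨y, hy⟩]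

/-- **Local diffeomorphism at a pinched point of the smooth piece**: if `Ψ : ↥O → 𝓢` is smooth on
`val⁻¹' W` (`W ⊆ O` open) and `‖(Ψ^* g − η)(z)‖ < 1` at `z ∈ W`, then `Ψ` is a local diffeomorphism
at `z`. [cite: ONeill1983, Ch. 5, Lemma 5.26] -/
theorem isLocalDiffeomorphAt_of_norm_deviationExtend_lt_one_of_contMDiffOn {O : Opens E4}
    (Ψ : O → 𝓢.carrier) {W : Set E4} (hWo : IsOpen W) (hW : W ⊆ (O : Set E4))
    (hΨ : ContMDiffOn 𝓘(ℝ, E4) (𝓡 4) ∞ Ψ (Subtype.val ⁻¹' W)) (z : O) (hzW : (z : E4) ∈ W)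
    (h : ‖𝓢.deviationExtend (Minkowski.backgroundOn O) Ψ z‖ < 1) :
    IsLocalDiffeomorphAt 𝓘(ℝ, E4) (𝓡 4) ∞ Ψ z := by
  have hψ : ContMDiffOn 𝓘(ℝ, E4) (𝓡 4) ∞ (Ψ ∘ (chartAt E4 z).symm) W :=
    𝓢.contMDiffOn_comp_chartAt_symm_of_contMDiffOn (Minkowski.backgroundOn O) Ψ z hW hΨ
  have hd := 𝓢.mdifferentiableAt_of_contMDiffOn_preimage (Minkowski.backgroundOn O) Ψ hWo hΨ z.2 hzW
  have hn : ‖𝓢.metricInCoords (Ψ ∘ (chartAt E4 z).symm) z - Minkowski.bilin‖ < 1 :=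
    (𝓢.norm_metricInCoords_comp_chartAt_symm_sub_of_mdifferentiableAt (Minkowski.backgroundOn O) Ψ z
      z.2 hd).trans_lt h
  have h1 : IsLocalDiffeomorphAt 𝓘(ℝ, E4) (𝓡 4) ∞ (Ψ ∘ (chartAt E4 z).symm) (z : E4) :=
    𝓢.isLocalDiffeomorphAt_of_norm_metricInCoords_sub_lt_one hWo hψ hzW hn
  have h2 : IsLocalDiffeomorphAt 𝓘(ℝ, E4) (𝓡 4) ∞
      ((Ψ ∘ (chartAt E4 z).symm) ∘ (Subtype.val : O → E4)) z :=
    IsLocalDiffeomorphAt.comp (hf := isLocalDiffeomorph_subtypeVal (I := 𝓘(ℝ, E4)) O z) (hg := h1)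
  rwa [comp_chartAt_symm_comp_subtypeVal] at h2

/-- **`IsLocalDiffeomorphOn` on the pinched smooth piece.** [cite: ONeill1983, Ch. 5, Lemma 5.26] -/
theorem isLocalDiffeomorphOn_of_norm_deviationExtend_lt_one_of_contMDiffOn {O : Opens E4}
    (Ψ : O → 𝓢.carrier) {W : Set E4} (hWo : IsOpen W) (hW : W ⊆ (O : Set E4))
    (hΨ : ContMDiffOn 𝓘(ℝ, E4) (𝓡 4) ∞ Ψ (Subtype.val ⁻¹' W))
    (h : ∀ y ∈ W, ‖𝓢.deviationExtend (Minkowski.backgroundOn O) Ψ y‖ < 1) {U : Set O}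
    (hU : U ⊆ Subtype.val ⁻¹' W) : IsLocalDiffeomorphOn 𝓘(ℝ, E4) (𝓡 4) ∞ Ψ U := fun z ↦
  𝓢.isLocalDiffeomorphAt_of_norm_deviationExtend_lt_one_of_contMDiffOn Ψ hWo hW hΨ z.1 (hU z.2)
    (h _ (hU z.2))

/-- **Orientation on a preconnected pinched piece from one point.** For `Ψ : ↥O → 𝓢` smooth on
`val⁻¹' W`, pinched on `W`, and a preconnected `S ⊆ W`: if `dΨ(∂₀)` is future-directed at one point
of `S`, it is so at every point of `S`. [cite: ONeill1983, Ch. 5, Lemma 5.26 ff., p. 145] -/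
theorem isFutureDirected_mfderiv_basisVector_zero_of_isPreconnected_of_contMDiffOn {O : Opens E4}
    (Ψ : O → 𝓢.carrier) {W : Set E4} (hWo : IsOpen W) (hW : W ⊆ (O : Set E4))
    (hΨ : ContMDiffOn 𝓘(ℝ, E4) (𝓡 4) ∞ Ψ (Subtype.val ⁻¹' W))
    (h : ∀ y ∈ W, ‖𝓢.deviationExtend (Minkowski.backgroundOn O) Ψ y‖ < 1) {S : Set E4}
    (hS : IsPreconnected S) (hSW : S ⊆ W) {z₁ : O} (hz₁ : (z₁ : E4) ∈ S)
    (h₁ : 𝓢.timeOrientation.IsFutureDirected (mfderiv 𝓘(ℝ, E4) (𝓡 4) Ψ z₁ (E4.basisVector 0)))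
    (z : O) (hz : (z : E4) ∈ S) :
    𝓢.timeOrientation.IsFutureDirected (mfderiv 𝓘(ℝ, E4) (𝓡 4) Ψ z (E4.basisVector 0)) := by
  set ψ : E4 → 𝓢.carrier := Ψ ∘ (chartAt E4 z₁).symm with hψdef
  have hψ : ContMDiffOn 𝓘(ℝ, E4) (𝓡 4) ∞ ψ W :=
    𝓢.contMDiffOn_comp_chartAt_symm_of_contMDiffOn (Minkowski.backgroundOn O) Ψ z₁ hW hΨ
  have hdiff : ∀ w : O, (w : E4) ∈ W → MDifferentiableAt 𝓘(ℝ, E4) (𝓡 4) Ψ w := fun w hw ↦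
    𝓢.mdifferentiableAt_of_contMDiffOn_preimage (Minkowski.backgroundOn O) Ψ hWo hΨ w.2 hw
  have hd : ∀ w : O, (w : E4) ∈ W → mfderiv 𝓘(ℝ, E4) (𝓡 4) ψ (w : E4) (E4.basisVector 0) =
      mfderiv 𝓘(ℝ, E4) (𝓡 4) Ψ w (E4.basisVector 0) := fun w hw ↦
    𝓢.mfderiv_comp_chartAt_symm_apply (Minkowski.backgroundOn O) Ψ z₁ w.2 (hdiff w hw) _
  have hc : ∀ y ∈ S, 𝓢.metric.IsCausal (mfderiv 𝓘(ℝ, E4) (𝓡 4) ψ y (E4.basisVector 0)) := by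
    intro y hy
    have hn : ‖𝓢.metricInCoords ψ y - Minkowski.bilin‖ < 1 :=
      (𝓢.norm_metricInCoords_comp_chartAt_symm_sub_of_mdifferentiableAt (Minkowski.backgroundOn O) Ψ
        z₁ (hW (hSW hy)) (hdiff ⟨y, hW (hSW hy)⟩ (hSW hy))).trans_lt (h y (hSW hy))
    exact (𝓢.isTimelike_mfderiv_basisVector_zero_of_norm_metricInCoords_sub_lt_one hn).isCausal
  have hiff : ∀ w : O, (w : E4) ∈ W →
      (𝓢.timeOrientation.IsFutureDirected (mfderiv 𝓘(ℝ, E4) (𝓡 4) ψ (w : E4) (E4.basisVector 0)) ↔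
        𝓢.timeOrientation.IsFutureDirected (mfderiv 𝓘(ℝ, E4) (𝓡 4) Ψ w (E4.basisVector 0))) := by
    intro w hw
    have hp : (chartAt E4 z₁).symm (w : E4) = w := Subtype.ext (OpensChart.chartAt_symm_val z₁ w.2)
    rw [hd w hw]
    show 𝓢.timeOrientation.IsFutureDirected (x := Ψ ((chartAt E4 z₁).symm (w : E4))) _ ↔ _
    rw [hp]
  have key := 𝓢.isFutureDirected_mfderiv_of_isPreconnected hWo hψ hS hSW (E4.basisVector 0) hc hz₁
    ((hiff z₁ (hSW hz₁)).2 h₁) z hz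
  exact (hiff z (hSW hz)).1 key

end Spacetime

end Literature.Geometry.Lorentzian

end
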